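import Summits.Ventures.HSemireg.MarkmanClassStatement
import HarnessLib

/-!
# Venture HSemireg — Markman's CLASS HYPOTHESIS as a predicate: `IsMarkmanKappaShape` (the class-side conjuncts of an
# anchor seed, in the form [Mar25] Cor. 1.3.2 + Lemma 2.2.7 / Cor. 4.0.4 + Thm. 1.4.1(4) = [Mar25b] §4 (b)(c) print them for `e = 2`)

HONEST FRAMING. Lean index of the computation cell `pub-hsemireg` (seat p5); companion of `MarkmanClassStatement.lean`
(the printed passages, the arrow-by-arrow map and the kernel-checked POINTWISE class statement live there). This file only
DEFINES the class-side hypothesis of Markman's strategy as a predicate on the tree's carriers and proves its bookkeeping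
lemmas; nothing about any explicit variety is asserted (the cell's census rows (I3) of `theory/TH2-ASSEMBLY-NOTE-2PAGE.md`
§0 are its intended witnesses, BY VALUE); nothing here says that HC, HC_CM or HC_AV is proved.

* `IsMarkmanKappaShape n d P ψ₀ h I κ w` (PREDICATE): `w` is a NON-ZERO RATIONAL class of the Weil plane
  `weilClassesOf P ψ₀ n d`, `κ_n = q·hⁿ + w` (`q ∈ ℚ`) and `κ_p = c_p·hᵖ` (`c_p ∈ ℚ`) for `p ∈ I`, `p ≠ n` — [Mar25]
  Cor. 1.3.2 («`κ(E)` is `Spin(V)_P`-invariant … Consequently, `κ(E)` remains of Hodge-type, under every deformations of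
  `(X×X̂,η,h)` as a polarized abelian variety of Weil-type») + Lemma 2.2.7 / Cor. 4.0.4, proof («the subring
  `(∧^*(V_ℚ))^{Spin(V)_P}` consists of the direct sum of the rational 2-dimensional subspace of Hodge-Weil classes in
  `∧^{2n}(V_ℚ)^{Spin(V)_P}` and the space of powers of classes in the one-dimensional `∧²(V_ℚ)^{Spin(V)_P}`») + Thm.
  1.4.1(4) (the Weil part is non-zero) — equivalently [Mar25b] §4 conditions (b)+(c) read through eq. (1.1) for `K`
  imaginary quadratic (`𝒜² = ℚ·h`, [Mar25] §1.3). These are exactly the class conjuncts of the assembly seat's (p7)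
  `HasSeedOn` / `HasHyperbolicSeedOn` in `AmplificationChainAssembly.lean`; the adapters (shape ∧ object clause ⟹ seed, in
  Markman's polarization or in the symmetrised class) and the component-level reading of the printed statement live in the
  proof-only companion `MarkmanClassStatementAssembly.lean`, which imports both files.
* `IsMarkmanKappaShape.smul` — rescaling `h ↦ c·h`, `c ∈ ℚ^×`; `IsMarkmanKappaShape.symmetrised` — from Markman's
  polarization `h` (`ψ₀^*h = d·h`, `ι^*a = m·h`) to the tree's `symmetrisedClass d P ψ₀ ι a = 2dm·h` (`Transfer.lean`), the
  class in which `HasLocallyAlgebraicWeilAnchor` / `weilFamilyReach_hyperbolic` are phrased.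
* `weilClassesOf_le_algebraicClasses_of_isMarkmanKappaShape` — Markman's pointwise class statement
  (`MarkmanClassStatement.weilClassesOf_le_algebraicClasses_of_kappa_hpow`) read from the predicate: shape ∧ `κ_n`
  algebraic on `(A, φ)` ⟹ the Weil plane of `(A, φ)` is algebraic.

`-- TODO(general form): [Mar25b §4] for a CM field K with [K:ℚ] = e > 2: HW(A,η) is e-dimensional, 𝒜² is`
`-- e/2-dimensional and δ ∈ Im Sym^{d/2}(𝒜²); the tree's Weil plane `weilClassesOf` is imaginary-quadratic only.`

References: [Markman2025SecantWeil] arXiv:2502.03415 v2, §1.3, Cor. 1.3.2 (p. 6), Thm. 1.4.1 (p. 7), Lemma 2.2.7 (p. 16),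
Cor. 4.0.4 (p. 27) (preprint, unrefereed; theorem numbers of the PUBLIC v2 and page numbers of its PDF throughout this file —
concordance: the public «Cor. 4.0.4» is numbered «Corollary 4.0.7» in the held e-print rendering `paper:arxiv-2502.03415`, same
statement and proof); [Markman2025SurveySecant] arXiv:2509.23403, §1.1 eq. (1.1), §4; [vanGeemen1994HodgeAV] LNM 1594, 4.9,
Lemma 5.2.
-/

noncomputable section

open CategoryTheory AlgebraicGeometry

namespace Summit.Ventures.HSemireg

open Literature.AlgebraicGeometry Literature.AlgebraicGeometry.Motives
open Literature.AlgebraicGeometry.HodgeTheory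
open Literature.AlgebraicTopology.SingularHomology

/-! ## The class-side hypothesis of Markman's strategy, for `K = ℚ(√-d)` -/

/-- **Markman's class hypothesis at an anchor, `e = 2` form** (PREDICATE, nothing asserted; the cell's census rows
(I3) are its intended witnesses). For an abelian variety `P` with `ψ₀ : P ⟶ P` (intended `ψ₀ ≫ ψ₀ = -d`), a degree-2
class `h` (the polarization), a set of degrees `I` and graded classes `κ_p ∈ H²ᵖ(P(ℂ); ℂ)` (the `κ`- or Chern-character
classes of the anchor object in the degrees the semiregularity theorem controls): `w` is a NON-ZERO RATIONAL class of the
Weil plane `weilClassesOf P ψ₀ n d`, `κ_n = q·hⁿ + w` for some `q ∈ ℚ`, and `κ_p = c_p·hᵖ` (`c_p ∈ ℚ`) for `p ∈ I`,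
`p ≠ n`. In print: [Mar25] Cor. 1.3.2 + Lemma 2.2.7 / Cor. 4.0.4 («`κ(𝓔)` lies in powers of `h` ⊕ Hodge–Weil classes») and Thm.
1.4.1(4) (non-zero Weil part); [Mar25b] §4 (b)+(c) through eq. (1.1) with `Im[Sym^{d/2}(𝒜²)] = ℚ·h^{d/2}` (§1.3).
[cite: Markman2025SecantWeil, Cor. 1.3.2, Lemma 2.2.7, Cor. 4.0.4 (proof) and Thm. 1.4.1 (3)(4) (preprint)]
[cite: Markman2025SurveySecant, §4 conditions (b)(c) and §1.1 eq. (1.1)] -/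
def IsMarkmanKappaShape (n d : ℕ) (P : AbelianVariety ℂ) (ψ₀ : P ⟶ P) (h : complexBetti P.X 2) (I : Finset ℕ)
    (κ : (p : ℕ) → complexBetti P.X (2 * p)) (w : complexBetti P.X (2 * n)) : Prop :=
  w ∈ weilClassesOf P ψ₀ n d ∧ IsRationalClass w ∧ w ≠ 0 ∧
    ∃ (q : ℚ) (c : ℕ → ℚ), κ n = ((q : ℚ) : ℂ) • cupPowTwo h n + w ∧
      ∀ p ∈ I, p ≠ n → κ p = ((c p : ℚ) : ℂ) • cupPowTwo h p

namespace IsMarkmanKappaShape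

variable {n d : ℕ} {P : AbelianVariety ℂ} {ψ₀ : P ⟶ P} {h : complexBetti P.X 2} {I : Finset ℕ}
  {κ : (p : ℕ) → complexBetti P.X (2 * p)} {w : complexBetti P.X (2 * n)}

/-- The Weil part is a class of the Weil plane. [cite: Markman2025SecantWeil, Lemma 2.2.7 and Cor. 4.0.4 (proof)] -/
theorem mem_weilClassesOf (hS : IsMarkmanKappaShape n d P ψ₀ h I κ w) : w ∈ weilClassesOf P ψ₀ n d := hS.1

/-- The Weil part is rational. [cite: Markman2025SecantWeil, Lemma 2.2.7 and Cor. 4.0.4 (proof)] -/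
theorem isRationalClass (hS : IsMarkmanKappaShape n d P ψ₀ h I κ w) : IsRationalClass w := hS.2.1

/-- The Weil part is non-zero. [cite: Markman2025SecantWeil, Thm. 1.4.1 (4)] -/
theorem ne_zero (hS : IsMarkmanKappaShape n d P ψ₀ h I κ w) : w ≠ 0 := hS.2.2.1

/-- The shape of the middle class: `κ_n = q·hⁿ + w`. [cite: Markman2025SecantWeil, Lemma 2.2.7 and Cor. 4.0.4 (proof)] -/
theorem exists_eq_add (hS : IsMarkmanKappaShape n d P ψ₀ h I κ w) :
    ∃ q : ℚ, κ n = ((q : ℚ) : ℂ) • cupPowTwo h n + w := by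
  obtain ⟨q, -, hq, -⟩ := hS.2.2.2
  exact ⟨q, hq⟩

/-- **Rescaling the polarization class**: the shape for `h` gives the shape for `c·h`, `c ∈ ℚ^×` (`(c·h)ᵖ = cᵖ·hᵖ`,
so `q ↦ q/cⁿ`, `c_p ↦ c_p/cᵖ`; the Weil part is unchanged). Used to pass from Markman's `h` to the tree's
`K`-symmetrised hyperplane class. [cite: Markman2025SecantWeil, §1.3] -/
theorem smul (hS : IsMarkmanKappaShape n d P ψ₀ h I κ w) {c : ℚ} (hc : c ≠ 0) :
    IsMarkmanKappaShape n d P ψ₀ (((c : ℚ) : ℂ) • h) I κ w := by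
  obtain ⟨hwW, hwr, hw0, q, cf, hκn, hκp⟩ := hS
  have hcC : ((c : ℚ) : ℂ) ≠ 0 := by exact_mod_cast hc
  refine ⟨hwW, hwr, hw0, q / c ^ n, fun p ↦ cf p / c ^ p, ?_, fun p hp hpn ↦ ?_⟩
  · rw [hκn, Literature.AlgebraicGeometry.HodgeTheory.cupPowTwo_smul, smul_smul]
    congr 2
    push_cast
    field_simp
  · rw [hκp p hp hpn, Literature.AlgebraicGeometry.HodgeTheory.cupPowTwo_smul, smul_smul]
    congr 2
    push_cast
    field_simp

end IsMarkmanKappaShape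

/-- **The class hypothesis in Markman's polarization `h` gives it in the tree's currency** `h_K = symmetrisedClass d P ψ₀ ι a`
(`= 2dm·h` when `ι^*a = m·h`, `m ∈ ℚ^×`, `d ≥ 1`, `ψ₀^*h = d·h`). This is how a census certificate (I3), computed in
Markman's invariant polarization, feeds the Weil-anchor predicates. [cite: Markman2025SecantWeil, §1.3 and Cor. 4.0.4 (proof)] -/
theorem IsMarkmanKappaShape.symmetrised {n d : ℕ} {P : AbelianVariety ℂ} {ψ₀ : P ⟶ P} {h : complexBetti P.X 2}
    {I : Finset ℕ} {κ : (p : ℕ) → complexBetti P.X (2 * p)} {w : complexBetti P.X (2 * n)}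
    (hS : IsMarkmanKappaShape n d P ψ₀ h I κ w) (hd : 0 < d) (ι : ProjectiveEmbedding P.X)
    (a : complexBetti (projectiveSpace ι.n ℂ) 2) {m : ℚ} (hm : m ≠ 0)
    (hι : complexBetti.map ι.ι 2 a = ((m : ℚ) : ℂ) • h)
    (hψh : complexBetti.map ψ₀.hom.hom.hom 2 h = (d : ℂ) • h) :
    IsMarkmanKappaShape n d P ψ₀ (symmetrisedClass d P ψ₀ ι a) I κ w := by
  rw [symmetrisedClass_eq_smul_of_map_eq ι a hι hψh]
  refine hS.smul ?_
  have hd' : (d : ℚ) ≠ 0 := by exact_mod_cast hd.ne'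
  exact mul_ne_zero (mul_ne_zero two_ne_zero hd') hm

/-! ## The pointwise class statement read from the predicate -/

section Pointwise

variable {A : AbelianVariety ℂ} {n d : ℕ}

/-- **Markman's class statement from the class hypothesis — the form the assembly consumes.** On a complex abelian
`2n`-fold `A` with `φ ≫ φ = -d` (`n, d ≥ 1`), `h` a rational `(1,1)` class: `IsMarkmanKappaShape n d A φ h I κ w` and
`κ_n` ALGEBRAIC (the output of the semiregularity theorem at this member of the component) ⟹ the Weil plane of `(A, φ)`
is algebraic. [cite: Markman2025SurveySecant, §4] [cite: Markman2025SecantWeil, proof of Thm. 1.5.1 (v2 p. 88)] -/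
theorem weilClassesOf_le_algebraicClasses_of_isMarkmanKappaShape (hA : A.dim = 2 * n) (hn : 0 < n) (hd : 0 < d)
    {φ : A ⟶ A} (hφ : φ ≫ φ = -(d • 𝟙 A)) {h : complexBetti A.X 2} (hh : IsRationalClass h)
    (hh11 : IsOfHodgeType A.dim A.X 2 1 1 h) {I : Finset ℕ} {κ : (p : ℕ) → complexBetti A.X (2 * p)}
    {w : complexBetti A.X (2 * n)} (hS : IsMarkmanKappaShape n d A φ h I κ w) (hκ : κ n ∈ algebraicClasses A.X n) :
    weilClassesOf A φ n d ≤ algebraicClasses A.X n := by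
  obtain ⟨q, hq⟩ := hS.exists_eq_add
  exact weilClassesOf_le_algebraicClasses_of_kappa_hpow hA hn hd hφ hh hh11 hκ hq hS.mem_weilClassesOf hS.ne_zero

end Pointwise

end Summit.Ventures.HSemireg

end
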